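import Summits.AtomisticToContinuum.Crystallization.Theses.BraggSlacknessRigidity
import Literature.MathematicalPhysics.StatisticalMechanics.CrystallizationLocalLimit
import Literature.MathematicalPhysics.StatisticalMechanics.LocalMatchingCompactness
import Summits.AtomisticToContinuum.Crystallization.Theorems.BraggSlacknessRigidityHcpDiffractionRigidityDenseCentres
import Summits.AtomisticToContinuum.Crystallization.Theorems.BraggSlacknessRigidityHcpDiffractionRigidityQuietCentres
import Summits.AtomisticToContinuum.Crystallization.Theorems.BraggSlacknessRigidityHcpDiffractionRigidityAdmissibleApprox
import Summits.AtomisticToContinuum.Crystallization.Theorems.BraggSlacknessRigidityHcpDiffractionRigidityDiagonalCentres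
import Summits.AtomisticToContinuum.Crystallization.Theorems.BraggSlacknessRigidityHcpDiffractionRigidityWindowsReturn
import Summits.AtomisticToContinuum.Crystallization.Theorems.BraggSlacknessRigidityHcpDiffractionRigidityLocalLimitTransfer
import Summits.AtomisticToContinuum.Crystallization.Theorems.BraggSlacknessRigidityHcpDiffractionRigidityLatticeConfinementRat
import Summits.AtomisticToContinuum.Crystallization.Theorems.BraggSlacknessRigidityHcpDiffractionRigidityWindowsOfEssentialPeriodicity
import Summits.AtomisticToContinuum.Crystallization.Theorems.BraggSlacknessRigidityHcpDiffractionRigidityEssentialPeriodicityIrratArith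
import Summits.AtomisticToContinuum.Crystallization.Theorems.BraggSlacknessRigidityHcpDiffractionRigidityEssentialPeriodicityOfArith
import Summits.AtomisticToContinuum.Crystallization.Theorems.BraggSlacknessRigidityHcpDiffractionRigidityEssentialPeriodicityRat
import Summits.AtomisticToContinuum.Crystallization.Theorems.BraggSlacknessRigidityHcpDiffractionRigidityEssentialPeriodLatticeTransc
import Summits.AtomisticToContinuum.Crystallization.Theorems.BraggSlacknessRigidityHcpDiffractionRigidityTemplateLatticeSplit
import HarnessLib.Audit

/-!
# Skeleton (line `registered`, reshaped by lead c3, continued by lead c4 — v9) for crux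
`BraggSlacknessRigidity.HcpDiffractionRigidity`
(item stmt-AtomisticToContinuum-13166, route route-AtomisticToContinuum-BraggSlacknessRigidity, rank 2, XL)

Crux (FIXED, concluded BY NAME below): hcp-template diffraction rigidity, finite-`N` form.

THE CUT.  The registered birth skeleton had two stubs, A = `stub_typicalCentres` (windowed
transfer of S2/S3 to typical centres) and B = `stub_quietExactWindowsRigidity` (rigidity of quiet
exact windows).  This reshape keeps the composition idea (A then B then the Literature matching
lemma) and cuts each of A and B into registered stubs that are either routine bookkeeping or ONE
clean analytic / arithmetic fact, so that pieces land as `--supports` while the heart is attacked.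
Two deliberate changes of the A/B interface, both forced by the proofs:

* the Bragg-QUIET window condition (Q) is stated with GAUSSIAN windows
  `w_L(y) = exp(-‖y‖²/L²)` instead of sharp balls `‖y‖ ≤ L`:
  `∫ h(ξ) |Σ_i w_L(y_i) e^{2πi⟨ξ,y_i⟩}|² dξ ≤ ε Σ_i w_L(y_i)²` ("per particle", weights squared).
  Gaussian windows make the Lebesgue-centre average of windowed intensities an explicit Gaussian
  pair sum (product of two Gaussians in the centre integrates to a Gaussian of the difference), make
  the Fourier tails super-exponentially small (all Gaussian Fourier facts are in Mathlib), make the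
  particle-centre/Lebesgue-centre comparison cost `O(L)` instead of a boundary shell `O(L²)`, and
  make (Q) pass to local limits with no boundary-sphere ambiguity;
* the per-particle normalisation is kept (it is what excludes rods, sheets and sparse junk in the
  limit), so the Markov step over centres needs NON-SPARSENESS of typical particles; this is the
  separate analytic stub `stub_denseCentres` (small-angle S3: a two-scale Gaussian kernel with
  Fourier transform vanishing at `0` and negligible beyond the first Bragg radius).

STUBS (v2: 7; v9 (lead c4): B2c = glue over B2c₁ (glue over B2c₁ₐ `stub_essentialPeriodLattice` —
itself glue by cases over the LANDED transcendental theorem `stub_essentialPeriodLatticeTransc` and the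
research kernel B2c₁ₐ′ `stub_essentialPeriodLatticeAlg` (h²/a² algebraic irrational) — and the landed
B2c₁ᵦ `stub_templateLatticeSplit`), B2c₂ `stub_essentialPeriodicityIrratArith` and B2b₀
`stub_essentialPeriodicityOfArith`; EVERY stub but the kernel B2c₁ₐ′ has landed and is imported from
`Theorems/`; ONE open):
* `stub_denseCentres`      (Fourier, M/L): hard core + S3 ⇒ ∀ε ∃θ ∃L₀ ∀L ≥ L₀, eventually in N, at most
  εN particles have Gaussian mass `Σ_j w_L(x_j - x_i)² < θ L³`.
* `stub_quietCentres`      (Fourier, L): hard core + S3 ⇒ for admissible h and ε, θ > 0, ∃L₁ ∀L ≥ L₁,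
  eventually in N, at most εN particles are θ-dense at scale L and have windowed intensity
  `> ε ·` Gaussian mass (Lebesgue-centre averaging + convolution identity + almost orthogonality
  + Markov).
* `stub_admissibleApprox`  (analysis, M): a countable family of admissible test functions that
  approximates every admissible h uniformly in the windowed intensity of every δ-separated weighted
  configuration (almost orthogonality `∫_K |Σ c_i e^{2πi⟨ξ,y_i⟩}|² ≤ C_{K,δ} Σ c_i²` + separability).
* `stub_diagonalCentres`   (bookkeeping, M): hard core + S2 + the three outputs above ⇒ Goal A
  (Markov on S2 for exact windows, union bound over finitely many active constraints per N,
  diagonal activation, recentring at the chosen particle, extension from the family to all h).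
* `stub_localLimitTransfer` (bookkeeping + light analysis, M): Goal-B hypotheses on a sequence
  `y_j` ⇒ a subsequence converging locally (two-way ε-matching on balls) to a δ-separated set
  `Λ ∋ 0` with ALL pair distances in `D_P` and Gaussian-quiet windows (tsum form).
* `stub_limitRigidity`     (THE HEART; since v3 a sorry-free case split over four stubs): such a `Λ`
  (for an hcp template) contains, for every radius, an ε-exact translated window of ONE periodic
  configuration `Q`.  v3 (after A1–A4, B1, B3 landed): B2a `stub_latticeConfinementRat` (Gram
  integrality, `h²/a² ∈ ℚ`), B2b `stub_essentialPeriodicityRat` (quiet spectrum on a commensurate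
  lattice ⇒ essentially periodic), B2b' `stub_windowsOfEssentialPeriodicity` (windows + pigeonhole),
  B2c `stub_limitRigidityIrrat` (the research heart, `h²/a² ∉ ℚ`: layered confinement + Anning–Erdős).
* `stub_windowsReturn`     (bookkeeping, S): local convergence to `Λ` + large `Q`-windows in `Λ`
  ⇒ the Goal-B conclusion (re-centred subsequence eventually two-way matched with `Q`).
Assembly: `typicalCentres_of_stubs`, `quietExactWindowsRigidity_of_stubs` (sorry-free glue),
`HcpDiffractionRigidity_of_goals` (sorry-free, as in the birth skeleton, via
`PeriodicConfiguration.tendsto_sum_of_eventually_near'`), and `HcpDiffractionRigidity_of`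
concluding the crux BY NAME from the seven named stubs.

Disproof used: none exists for this crux (`ledger crux ls`, 2026-08-17).  Registered stub
signatures are fully inlined (`open scoped Classical` is needed for the `Finset.filter`s).
-/

noncomputable section

namespace Summit.AtomisticToContinuum.Crystallization.Cruxes.HcpDiffractionRigidity.Birth

open Literature.MathematicalPhysics.StatisticalMechanics
open Summit.AtomisticToContinuum.Crystallization.Theses.BraggSlacknessRigidity
open scoped BigOperators Classical
open Filter

/-! ## Readable names (`Goal.*`) for the two halves and the crux -/

namespace Goal

/-- Goal A (typical centres, Gaussian-window form): windowed transfer of S2/S3 to one centre per `N`. -/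
def TypicalCentres : Prop := ∀ (P : Literature.MathematicalPhysics.StatisticalMechanics.PeriodicConfiguration 3), (∃ (a h : ℝ) (ha : a ≠ 0) (hh : h ≠ 0), P = Literature.MathematicalPhysics.StatisticalMechanics.hcpPeriodicConfiguration ha hh) → ∀ δ : ℝ, 0 < δ → ∀ x : (N : ℕ) → (Fin N → EuclideanSpace ℝ (Fin 3)), (∀ (N : ℕ) (i j : Fin N), i ≠ j → δ ≤ dist (x N i) (x N j)) → (∀ R η : ℝ, 0 < η → Filter.Tendsto (fun N : ℕ => (Nat.card {p : Fin N × Fin N // p.1 ≠ p.2 ∧ dist (x N p.1) (x N p.2) ≤ R ∧ ∀ a ∈ P.points, ∀ b ∈ P.points, η ≤ |dist (x N p.1) (x N p.2) - dist a b|} : ℝ) / N) Filter.atTop (nhds 0)) → (∀ h : EuclideanSpace ℝ (Fin 3) → ℝ, Continuous h → HasCompactSupport h → (∀ ξ ∈ tsupport h, ξ ≠ 0 ∧ ∀ k : EuclideanSpace ℝ (Fin 3), (∀ g ∈ P.lattice, ∃ n : ℤ, inner ℝ k g = (n : ℝ)) → ‖ξ‖ ≠ ‖k‖) → Filter.Tendsto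 (fun N : ℕ => (∫ ξ, h ξ * ‖∑ j : Fin N, Complex.exp (2 * Real.pi * Complex.I * (inner ℝ ξ (x N j) : ℂ))‖ ^ 2) / N) Filter.atTop (nhds 0)) → ∃ (φ : ℕ → ℕ) (τ : ℕ → EuclideanSpace ℝ (Fin 3)), StrictMono φ ∧ (∀ j : ℕ, ∃ i : Fin (φ j), x (φ j) i + τ j = 0) ∧ (∀ R η : ℝ, 0 < η → ∀ᶠ j : ℕ in Filter.atTop, ∀ i i' : Fin (φ j), i ≠ i' → ‖x (φ j) i + τ j‖ ≤ R → ‖x (φ j) i' + τ j‖ ≤ R → ∃ a ∈ P.points, ∃ b ∈ P.points, |dist (x (φ j) i + τ j) (x (φ j) i' + τ j) - dist a b| < η) ∧ (∃ L : ℕ → ℝ, Filter.Tendsto L Filter.atTop Filter.atTop ∧ ∀ h : EuclideanSpace ℝ (Fin 3) → ℝ, Continuous h → HasCompactSupport h → (∀ ξ ∈ tsupport h, ξ ≠ 0 ∧ ∀ k : EuclideanSpace ℝ (Fin 3), (∀ g ∈ P.lattice, ∃ n : ℤ, inner ℝ k g = (n : ℝ)) → ‖ξ‖ ≠ ‖k‖)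 → ∀ ε : ℝ, 0 < ε → ∀ᶠ t : ℕ in Filter.atTop, ∀ᶠ j : ℕ in Filter.atTop, (∫ ξ, h ξ * ‖∑ i : Fin (φ j), (Real.exp (-(‖x (φ j) i + τ j‖ ^ 2) / L t ^ 2) : ℂ) * Complex.exp (2 * Real.pi * Complex.I * (inner ℝ ξ (x (φ j) i + τ j) : ℂ))‖ ^ 2) ≤ ε * ∑ i : Fin (φ j), Real.exp (-(‖x (φ j) i + τ j‖ ^ 2) / L t ^ 2) ^ 2)

/-- Goal B (rigidity of quiet exact windows, Gaussian-window form). -/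
def QuietExactWindowsRigidity : Prop := ∀ (P : Literature.MathematicalPhysics.StatisticalMechanics.PeriodicConfiguration 3), (∃ (a h : ℝ) (ha : a ≠ 0) (hh : h ≠ 0), P = Literature.MathematicalPhysics.StatisticalMechanics.hcpPeriodicConfiguration ha hh) → ∀ δ : ℝ, 0 < δ → ∀ (n : ℕ → ℕ) (y : (j : ℕ) → (Fin (n j) → EuclideanSpace ℝ (Fin 3))), (∀ (j : ℕ) (i i' : Fin (n j)), i ≠ i' → δ ≤ dist (y j i) (y j i')) → (∀ j : ℕ, ∃ i : Fin (n j), y j i = 0) → (∀ R η : ℝ, 0 < η → ∀ᶠ j : ℕ in Filter.atTop, ∀ i i' : Fin (n j), i ≠ i' → ‖y j i‖ ≤ R → ‖y j i'‖ ≤ R → ∃ a ∈ P.points, ∃ b ∈ P.points, |dist (y j i) (y j i') - dist a b| < η) → (∃ L : ℕ → ℝ, Filter.Tendsto L Filter.atTop Filter.atTop ∧ ∀ h : EuclideanSpace ℝ (Fin 3) → ℝ, Continuous h → HasCompactSupport h → (∀ ξ ∈ tsupport h, ξ ≠ 0 ∧ ∀ k : EuclideanSpace ℝ (Fin 3), (∀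 g ∈ P.lattice, ∃ n : ℤ, inner ℝ k g = (n : ℝ)) → ‖ξ‖ ≠ ‖k‖) → ∀ ε : ℝ, 0 < ε → ∀ᶠ t : ℕ in Filter.atTop, ∀ᶠ j : ℕ in Filter.atTop, (∫ ξ, h ξ * ‖∑ i : Fin (n j), (Real.exp (-(‖y j i‖ ^ 2) / L t ^ 2) : ℂ) * Complex.exp (2 * Real.pi * Complex.I * (inner ℝ ξ (y j i) : ℂ))‖ ^ 2) ≤ ε * ∑ i : Fin (n j), Real.exp (-(‖y j i‖ ^ 2) / L t ^ 2) ^ 2) → ∃ (ψ : ℕ → ℕ) (σ : ℕ → EuclideanSpace ℝ (Fin 3)) (Q : Literature.MathematicalPhysics.StatisticalMechanics.PeriodicConfiguration 3), StrictMono ψ ∧ ∀ R ε : ℝ, 0 < ε → ∀ᶠ k : ℕ in Filter.atTop, (∀ s ∈ Q.points, ‖s‖ ≤ R → ∃ i : Fin (n (ψ k)), dist (y (ψ k) i + σ k) s ≤ ε) ∧ (∀ i : Fin (n (ψ k)), ‖y (ψ k) i + σ k‖ ≤ R → ∃ s ∈ Q.points, dist (y (ψ k) i + σ k) s ≤ 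ε)

/-- The crux, by name (a local abbreviation used only as the conclusion of the sorry-free assembly). -/
def Crux : Prop := Summit.AtomisticToContinuum.Crystallization.Theses.BraggSlacknessRigidity.HcpDiffractionRigidity

end Goal

/-! ## Registered stubs (the ONLY `sorry`s of this file)

### Half A: typical centres -/

/-- **STUB A1 — dense centres (non-sparseness of typical particles; Fourier, small-angle S3).**
For any periodic template `P`, hard core `δ` and a sequence `x^N` with Bragg-quiet structure factor
(S3, verbatim the crux hypothesis): for every `ε > 0` there are `θ > 0` and `L₀` such that for every
scale `L ≥ L₀`, eventually in `N`, at most `εN` particles `i` have Gaussian mass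
`Σ_j exp(-‖x_j - x_i‖²/L²)² < θ L³`.  (Two-scale kernel `ψ = G_a − (a/b)³ G_b`, `ψ̂(0) = 0`,
`0 ≤ ψ̂ ≤ a³ e^{-π a² |ξ|²}`; `(1/N) Σ_i |μ_N ∗ ψ (x_i)|² → small` by S3 inside the first Bragg
radius and Gaussian almost orthogonality outside; Chebyshev, using the self term `G_a(0) = 1`.) -/
theorem stub_denseCentres : ∀ (P : Literature.MathematicalPhysics.StatisticalMechanics.PeriodicConfiguration 3) (δ : ℝ), 0 < δ → ∀ x : (N : ℕ) → (Fin N → EuclideanSpace ℝ (Fin 3)), (∀ (N : ℕ) (i j : Fin N), i ≠ j → δ ≤ dist (x N i) (x N j)) → (∀ h : EuclideanSpace ℝ (Fin 3) → ℝ, Continuous h → HasCompactSupport h → (∀ ξ ∈ tsupport h, ξ ≠ 0 ∧ ∀ k : EuclideanSpace ℝ (Fin 3), (∀ g ∈ P.lattice, ∃ n : ℤ, inner ℝ k g = (n : ℝ)) → ‖ξ‖ ≠ ‖k‖) → Filter.Tendsto (fun N : ℕ => (∫ ξ, h ξ * ‖∑ j : Fin N, Complex.exp (2 * Real.pi * Complex.I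 * (inner ℝ ξ (x N j) : ℂ))‖ ^ 2) / N) Filter.atTop (nhds 0)) → ∀ ε : ℝ, 0 < ε → ∃ θ : ℝ, 0 < θ ∧ ∃ L₀ : ℝ, ∀ L : ℝ, L₀ ≤ L → ∀ᶠ N : ℕ in Filter.atTop, ((Finset.univ.filter (fun i : Fin N => ∑ j : Fin N, Real.exp (-(‖x N j - x N i‖ ^ 2) / L ^ 2) ^ 2 < θ * L ^ 3)).card : ℝ) ≤ ε * N :=
  Summit.AtomisticToContinuum.Crystallization.Theorems.stub_denseCentres

/-- **STUB A2 — quiet centres (Markov form of the windowed S3 transfer; Fourier).** For any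
periodic template `P`, hard core `δ` and a sequence `x^N` satisfying S3: for every admissible test
function `h` (continuous, compact support off `0` and off the Bragg spheres of `P`) and all
`ε, θ > 0` there is `L₁` such that for every `L ≥ L₁`, eventually in `N`, at most `εN` particles
`i` are `θ`-dense at scale `L` (Gaussian mass `≥ θL³`) and yet have Gaussian-windowed intensity
`∫ h |Σ_j e^{-‖x_j-x_i‖²/L²} e^{2πi⟨ξ,x_j-x_i⟩}|² > ε ·` Gaussian mass.  (Lebesgue-centre average
`= Σ_{j,k} c_L e^{-‖x_j-x_k‖²/2L²} 𝓕⁻¹h(x_j-x_k) = ∫ (h ∗ c_L 𝓕G)|S_N|²`; the part of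
`h ∗ c_L𝓕G` within `d/2` of `tsupport h` is admissible (S3 ⇒ `o(N)`), the rest is
super-exponentially small in `L` times the almost-orthogonality bound; particle centres cost
`O(L)` per centre; Markov.) -/
theorem stub_quietCentres : ∀ (P : Literature.MathematicalPhysics.StatisticalMechanics.PeriodicConfiguration 3) (δ : ℝ), 0 < δ → ∀ x : (N : ℕ) → (Fin N → EuclideanSpace ℝ (Fin 3)), (∀ (N : ℕ) (i j : Fin N), i ≠ j → δ ≤ dist (x N i) (x N j)) → (∀ h : EuclideanSpace ℝ (Fin 3) → ℝ, Continuous h → HasCompactSupport h → (∀ ξ ∈ tsupport h, ξ ≠ 0 ∧ ∀ k : EuclideanSpace ℝ (Fin 3), (∀ g ∈ P.lattice, ∃ n : ℤ, inner ℝ k g = (n : ℝ)) → ‖ξ‖ ≠ ‖k‖) → Filter.Tendsto (fun N : ℕ => (∫ ξ, h ξ * ‖∑ j : Fin N, Complex.exp (2 * Real.pi * Complex.I * (inner ℝ ξ (x N j) : ℂ))‖ ^ 2) / N) Filter.atTop (nhds 0)) → ∀ h : EuclideanSpace ℝ (Fin 3) → ℝ, Continuous h → HasCompactSupport h → (∀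 ξ ∈ tsupport h, ξ ≠ 0 ∧ ∀ k : EuclideanSpace ℝ (Fin 3), (∀ g ∈ P.lattice, ∃ n : ℤ, inner ℝ k g = (n : ℝ)) → ‖ξ‖ ≠ ‖k‖) → ∀ ε θ : ℝ, 0 < ε → 0 < θ → ∃ L₁ : ℝ, ∀ L : ℝ, L₁ ≤ L → ∀ᶠ N : ℕ in Filter.atTop, ((Finset.univ.filter (fun i : Fin N => θ * L ^ 3 ≤ ∑ j : Fin N, Real.exp (-(‖x N j - x N i‖ ^ 2) / L ^ 2) ^ 2 ∧ ε * ∑ j : Fin N, Real.exp (-(‖x N j - x N i‖ ^ 2) / L ^ 2) ^ 2 < ∫ ξ, h ξ * ‖∑ j : Fin N, (Real.exp (-(‖x N j - x N i‖ ^ 2) / L ^ 2) : ℂ) * Complex.exp (2 * Real.pi * Complex.I * (inner ℝ ξ (x N j - x N i) : ℂ))‖ ^ 2)).card : ℝ) ≤ ε * N :=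
  Summit.AtomisticToContinuum.Crystallization.Theorems.stub_quietCentres

/-- **STUB A3 — a countable approximating family of admissible test functions (analysis).**
For any periodic template `P` and hard core `δ > 0` there is a sequence `hf m` of admissible test
functions such that every admissible `h` is, for every `ε > 0`, `ε`-approximated by some `hf m`
in the windowed intensity of EVERY finite `δ`-separated configuration with arbitrary real weights:
`|∫ h |Σ c_i e^{2πi⟨ξ,y_i⟩}|² − ∫ (hf m) |Σ c_i e^{2πi⟨ξ,y_i⟩}|²| ≤ ε Σ c_i²`.
(Almost orthogonality `∫_K |Σ c_i e^{2πi⟨ξ,y_i⟩}|² ≤ C_{K,δ} Σ c_i²` via a Schwartz majorant of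
`1_K` and the weighted quadratic-form identity; a countable sup-norm-dense family in `C_c(U)`,
`U = {ξ ≠ 0, ‖ξ‖ ∉ Bragg radii}`, from a compact exhaustion of `U` and separability of `C(K)`.) -/
theorem stub_admissibleApprox : ∀ (P : Literature.MathematicalPhysics.StatisticalMechanics.PeriodicConfiguration 3) (δ : ℝ), 0 < δ → ∃ hf : ℕ → (EuclideanSpace ℝ (Fin 3) → ℝ), (∀ m : ℕ, Continuous (hf m) ∧ HasCompactSupport (hf m) ∧ ∀ ξ ∈ tsupport (hf m), ξ ≠ 0 ∧ ∀ k : EuclideanSpace ℝ (Fin 3), (∀ g ∈ P.lattice, ∃ n : ℤ, inner ℝ k g = (n : ℝ)) → ‖ξ‖ ≠ ‖k‖) ∧ ∀ h : EuclideanSpace ℝ (Fin 3) → ℝ, Continuous h → HasCompactSupport h → (∀ ξ ∈ tsupport h, ξ ≠ 0 ∧ ∀ k : EuclideanSpace ℝ (Fin 3), (∀ g ∈ P.lattice, ∃ n : ℤ, inner ℝ k g = (n : ℝ)) → ‖ξ‖ ≠ ‖k‖) → ∀ ε : ℝ, 0 < ε → ∃ m : ℕ, ∀ (n : ℕ) (y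 : Fin n → EuclideanSpace ℝ (Fin 3)) (c : Fin n → ℝ), (∀ i j : Fin n, i ≠ j → δ ≤ dist (y i) (y j)) → |(∫ ξ, h ξ * ‖∑ i : Fin n, (c i : ℂ) * Complex.exp (2 * Real.pi * Complex.I * (inner ℝ ξ (y i) : ℂ))‖ ^ 2) - ∫ ξ, hf m ξ * ‖∑ i : Fin n, (c i : ℂ) * Complex.exp (2 * Real.pi * Complex.I * (inner ℝ ξ (y i) : ℂ))‖ ^ 2| ≤ ε * ∑ i : Fin n, c i ^ 2 :=
  Summit.AtomisticToContinuum.Crystallization.Theorems.stub_admissibleApprox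

/-- **STUB A4 — diagonal choice of typical centres (bookkeeping).** From the hard core, the crux
hypothesis S2, and the conclusions of stubs A1 (dense centres), A2 (quiet centres) and A3
(approximating family) taken as hypotheses, Goal A follows: Markov on S2 gives, for every `(R, η)`,
`o(N)` centres with an `η`-bad pair in their `R`-window (a bad pair at range `2R` spoils at most
`(4R/δ+1)³` centres); activate each of the countably many constraints (exact windows `(k, 1/k)`,
density at scale `L_t`, quietness of family member `m` at level `2^{-q}` and scale `L_t`, `t ≥ m+q`)
only from the stage `N` where its eventual bound holds, with budgets summing to `< 1`, so that for
every large `N` a centre good for all active constraints exists; recentre there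
(`τ_N = -x_{i_N}`, `φ` = eventually the identity); extend from the family to all admissible `h`
by A3. -/
theorem stub_diagonalCentres : ∀ (P : Literature.MathematicalPhysics.StatisticalMechanics.PeriodicConfiguration 3) (δ : ℝ), 0 < δ → ∀ x : (N : ℕ) → (Fin N → EuclideanSpace ℝ (Fin 3)), (∀ (N : ℕ) (i j : Fin N), i ≠ j → δ ≤ dist (x N i) (x N j)) → (∀ R η : ℝ, 0 < η → Filter.Tendsto (fun N : ℕ => (Nat.card {p : Fin N × Fin N // p.1 ≠ p.2 ∧ dist (x N p.1) (x N p.2) ≤ R ∧ ∀ a ∈ P.points, ∀ b ∈ P.points, η ≤ |dist (x N p.1) (x N p.2) - dist a b|} : ℝ) / N) Filter.atTop (nhds 0)) → (∀ ε : ℝ, 0 < ε → ∃ θ : ℝ, 0 < θ ∧ ∃ L₀ : ℝ, ∀ L : ℝ, L₀ ≤ L → ∀ᶠ N : ℕ in Filter.atTop, ((Finset.univ.filter (fun i : Fin N => ∑ j : Fin N, Real.exp (-(‖x N j - x N i‖ ^ 2) / L ^ 2) ^ 2 < θ * L ^ 3)).card : ℝ) ≤ ε * N) → (∀ h : EuclideanSpace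 ℝ (Fin 3) → ℝ, Continuous h → HasCompactSupport h → (∀ ξ ∈ tsupport h, ξ ≠ 0 ∧ ∀ k : EuclideanSpace ℝ (Fin 3), (∀ g ∈ P.lattice, ∃ n : ℤ, inner ℝ k g = (n : ℝ)) → ‖ξ‖ ≠ ‖k‖) → ∀ ε θ : ℝ, 0 < ε → 0 < θ → ∃ L₁ : ℝ, ∀ L : ℝ, L₁ ≤ L → ∀ᶠ N : ℕ in Filter.atTop, ((Finset.univ.filter (fun i : Fin N => θ * L ^ 3 ≤ ∑ j : Fin N, Real.exp (-(‖x N j - x N i‖ ^ 2) / L ^ 2) ^ 2 ∧ ε * ∑ j : Fin N, Real.exp (-(‖x N j - x N i‖ ^ 2) / L ^ 2) ^ 2 < ∫ ξ, h ξ * ‖∑ j : Fin N, (Real.exp (-(‖x N j - x N i‖ ^ 2) / L ^ 2) : ℂ) * Complex.exp (2 * Real.pi * Complex.I * (inner ℝ ξ (x N j - x N i) : ℂ))‖ ^ 2)).card : ℝ) ≤ ε * N) → (∃ hf : ℕ → (EuclideanSpace ℝ (Fin 3) → ℝ), (∀ m : ℕ, Continuous (hf m) ∧ HasCompactSupport (hf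 m) ∧ ∀ ξ ∈ tsupport (hf m), ξ ≠ 0 ∧ ∀ k : EuclideanSpace ℝ (Fin 3), (∀ g ∈ P.lattice, ∃ n : ℤ, inner ℝ k g = (n : ℝ)) → ‖ξ‖ ≠ ‖k‖) ∧ ∀ h : EuclideanSpace ℝ (Fin 3) → ℝ, Continuous h → HasCompactSupport h → (∀ ξ ∈ tsupport h, ξ ≠ 0 ∧ ∀ k : EuclideanSpace ℝ (Fin 3), (∀ g ∈ P.lattice, ∃ n : ℤ, inner ℝ k g = (n : ℝ)) → ‖ξ‖ ≠ ‖k‖) → ∀ ε : ℝ, 0 < ε → ∃ m : ℕ, ∀ (n : ℕ) (y : Fin n → EuclideanSpace ℝ (Fin 3)) (c : Fin n → ℝ), (∀ i j : Fin n, i ≠ j → δ ≤ dist (y i) (y j)) → |(∫ ξ, h ξ * ‖∑ i : Fin n, (c i : ℂ) * Complex.exp (2 * Real.pi * Complex.I * (inner ℝ ξ (y i) : ℂ))‖ ^ 2) - ∫ ξ, hf m ξ * ‖∑ i : Fin n, (c i : ℂ) * Complex.exp (2 * Real.pi * Complex.I * (inner ℝ ξ (y i) : ℂ))‖ ^ 2|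 ≤ ε * ∑ i : Fin n, c i ^ 2) → ∃ (φ : ℕ → ℕ) (τ : ℕ → EuclideanSpace ℝ (Fin 3)), StrictMono φ ∧ (∀ j : ℕ, ∃ i : Fin (φ j), x (φ j) i + τ j = 0) ∧ (∀ R η : ℝ, 0 < η → ∀ᶠ j : ℕ in Filter.atTop, ∀ i i' : Fin (φ j), i ≠ i' → ‖x (φ j) i + τ j‖ ≤ R → ‖x (φ j) i' + τ j‖ ≤ R → ∃ a ∈ P.points, ∃ b ∈ P.points, |dist (x (φ j) i + τ j) (x (φ j) i' + τ j) - dist a b| < η) ∧ (∃ L : ℕ → ℝ, Filter.Tendsto L Filter.atTop Filter.atTop ∧ ∀ h : EuclideanSpace ℝ (Fin 3) → ℝ, Continuous h → HasCompactSupport h → (∀ ξ ∈ tsupport h, ξ ≠ 0 ∧ ∀ k : EuclideanSpace ℝ (Fin 3), (∀ g ∈ P.lattice, ∃ n : ℤ, inner ℝ k g = (n : ℝ)) → ‖ξ‖ ≠ ‖k‖) → ∀ ε : ℝ, 0 < ε → ∀ᶠ t : ℕ in Filter.atTop, ∀ᶠ j : ℕ in Filter.atTop, (∫ ξ, h ξ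 * ‖∑ i : Fin (φ j), (Real.exp (-(‖x (φ j) i + τ j‖ ^ 2) / L t ^ 2) : ℂ) * Complex.exp (2 * Real.pi * Complex.I * (inner ℝ ξ (x (φ j) i + τ j) : ℂ))‖ ^ 2) ≤ ε * ∑ i : Fin (φ j), Real.exp (-(‖x (φ j) i + τ j‖ ^ 2) / L t ^ 2) ^ 2) :=
  Summit.AtomisticToContinuum.Crystallization.Theorems.stub_diagonalCentres

/-! ### Half B: rigidity of quiet exact windows -/

/-- **STUB B1 — local limit with inherited exactness and quietness (bookkeeping + light analysis).**
For any periodic template `P` and a hard-core sequence of finite configurations `y_j` centred at a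
particle, with asymptotically exact windows and Gaussian-quiet windows along scales `L_t → ∞`,
some subsequence converges locally (two-way `ε`-matching on every ball about `0`) to a
`δ`-separated set `Λ ∋ 0` all of whose pair distances are template distances and whose Gaussian
windows are quiet along scales tending to infinity (tsum form).  (`exists_subseq_forall_eventually_ballMatch`;
`0 ∈ Λ` from the centring; distances pass to the limit because bounded template distance sets are
finite; the windowed intensity and the Gaussian mass at a fixed scale are continuous under local
convergence, with Gaussian tails uniformly small by the hard core.) -/
theorem stub_localLimitTransfer : ∀ (P : Literature.MathematicalPhysics.StatisticalMechanics.PeriodicConfiguration 3) (δ : ℝ), 0 < δ → ∀ (n : ℕ → ℕ) (y : (j : ℕ) → (Fin (n j) → EuclideanSpace ℝ (Fin 3))), (∀ (j : ℕ) (i i' : Fin (n j)), i ≠ i' → δ ≤ dist (y j i) (y j i')) → (∀ j : ℕ, ∃ i : Fin (n j), y j i = 0) → (∀ R η : ℝ, 0 < η → ∀ᶠ j : ℕ in Filter.atTop, ∀ i i' : Fin (n j), i ≠ i' → ‖y j i‖ ≤ R → ‖y j i'‖ ≤ R → ∃ a ∈ P.points, ∃ b ∈ P.points, |dist (y j i)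 (y j i') - dist a b| < η) → (∃ L : ℕ → ℝ, Filter.Tendsto L Filter.atTop Filter.atTop ∧ ∀ h : EuclideanSpace ℝ (Fin 3) → ℝ, Continuous h → HasCompactSupport h → (∀ ξ ∈ tsupport h, ξ ≠ 0 ∧ ∀ k : EuclideanSpace ℝ (Fin 3), (∀ g ∈ P.lattice, ∃ n : ℤ, inner ℝ k g = (n : ℝ)) → ‖ξ‖ ≠ ‖k‖) → ∀ ε : ℝ, 0 < ε → ∀ᶠ t : ℕ in Filter.atTop, ∀ᶠ j : ℕ in Filter.atTop, (∫ ξ, h ξ * ‖∑ i : Fin (n j), (Real.exp (-(‖y j i‖ ^ 2) / L t ^ 2) : ℂ) * Complex.exp (2 * Real.pi * Complex.I * (inner ℝ ξ (y j i) : ℂ))‖ ^ 2) ≤ ε * ∑ i : Fin (n j), Real.exp (-(‖y j i‖ ^ 2) / L t ^ 2) ^ 2) → ∃ (ψ : ℕ → ℕ) (Λ : Set (EuclideanSpace ℝ (Fin 3))), StrictMono ψ ∧ (∀ p ∈ Λ, ∀ q ∈ Λ, p ≠ q → δ ≤ dist p q) ∧ (0 : EuclideanSpace ℝ (Fin 3))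 ∈ Λ ∧ (∀ p ∈ Λ, ∀ q ∈ Λ, ∃ a ∈ P.points, ∃ b ∈ P.points, dist p q = dist a b) ∧ (∃ L : ℕ → ℝ, Filter.Tendsto L Filter.atTop Filter.atTop ∧ ∀ h : EuclideanSpace ℝ (Fin 3) → ℝ, Continuous h → HasCompactSupport h → (∀ ξ ∈ tsupport h, ξ ≠ 0 ∧ ∀ k : EuclideanSpace ℝ (Fin 3), (∀ g ∈ P.lattice, ∃ n : ℤ, inner ℝ k g = (n : ℝ)) → ‖ξ‖ ≠ ‖k‖) → ∀ ε : ℝ, 0 < ε → ∀ᶠ t : ℕ in Filter.atTop, (∫ ξ, h ξ * ‖∑' s : Λ, (Real.exp (-(‖(s : EuclideanSpace ℝ (Fin 3))‖ ^ 2) / L t ^ 2) : ℂ) * Complex.exp (2 * Real.pi * Complex.I * (inner ℝ ξ (s : EuclideanSpace ℝ (Fin 3)) : ℂ))‖ ^ 2) ≤ ε * ∑' s : Λ, Real.exp (-(‖(s : EuclideanSpace ℝ (Fin 3))‖ ^ 2) / L t ^ 2) ^ 2) ∧ (∀ R ε : ℝ, 0 < ε → ∀ᶠ k : ℕ in Filter.atTop,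 (∀ p ∈ Λ, ‖p‖ ≤ R → ∃ i : Fin (n (ψ k)), dist (y (ψ k) i) p ≤ ε) ∧ (∀ i : Fin (n (ψ k)), ‖y (ψ k) i‖ ≤ R → ∃ p ∈ Λ, dist (y (ψ k) i) p ≤ ε)) :=
  Summit.AtomisticToContinuum.Crystallization.Theorems.stub_localLimitTransfer

/-- **STUB B2a — lattice confinement, commensurate case (Gram integrality; size M).** For an hcp
template with `h² = q a²`, `q ∈ ℚ`, every squared template distance lies in `(a²/(12·den q)) ℕ`
(`dist_barlowPos_sq`); hence for a set `Λ ∋ 0` all of whose pair distances are template distances,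
`2⟨p, r⟩ = ‖p‖² + ‖r‖² − ‖p − r‖² ∈ (a²/(12 den q)) ℤ` for `p, r ∈ Λ`, and `Λ` lies in the
full-rank lattice `M` dual (up to that factor) to three independent vectors of `Λ` (completed by
orthogonal vectors of squared norm `a²` if `Λ` does not span), whose Gram matrix is `a²`-rational. -/
theorem stub_latticeConfinementRat : ∀ (a h : ℝ) (ha : a ≠ 0) (hh : h ≠ 0), (∃ q : ℚ, h ^ 2 = (q : ℝ) * a ^ 2) → ∀ Λ : Set (EuclideanSpace ℝ (Fin 3)), (0 : EuclideanSpace ℝ (Fin 3)) ∈ Λ → (∀ p ∈ Λ, ∀ q ∈ Λ, ∃ a' ∈ (Literature.MathematicalPhysics.StatisticalMechanics.hcpPeriodicConfiguration ha hh).points, ∃ b' ∈ (Literature.MathematicalPhysics.StatisticalMechanics.hcpPeriodicConfiguration ha hh).points, dist p q = dist a' b') → ∃ M : Submodule ℤ (EuclideanSpace ℝ (Fin 3)), DiscreteTopology M ∧ Submodule.span ℝ (M : Set (EuclideanSpace ℝ (Fin 3))) = ⊤ ∧ (∃ D : ℕ, 0 < D ∧ ∀ u ∈ M, ∀ v ∈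 M, ∃ n : ℤ, (D : ℝ) * inner ℝ u v = (n : ℝ) * a ^ 2) ∧ Λ ⊆ M :=
  Summit.AtomisticToContinuum.Crystallization.Theorems.stub_latticeConfinementRat

/-- **STUB B2b₀ — essential periodicity from quietness, periods and arithmetic (generic; analysis,
size L).** Let `Λ` be `δ`-separated inside a discrete `ℤ`-module `M` of `ℝ³`, Gaussian-quiet along
scales `L_t → ∞` off the Bragg set `Z` of a periodic template `P` (`Z = {0} ∪` the spheres through
the dual vectors), let `V` be a set of PERIODS (`⟨m, s⟩ ∈ ℤ` for `m ∈ V`, `s ∈ Λ`, so that `|S_t|²`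
is `V`-periodic), and suppose the ARITHMETIC input: every `ξ` all of whose `V`-translates lie in
`Z` pairs `(1/k)`-integrally with `M`.  Then `Λ` is essentially periodic under `M' = k • M`: for
every `z ∈ M'` the Gaussian mass of `{s ∈ Λ : s + z ∉ Λ}` is `o(`Gaussian mass`)` along `L_t`.
(Main pair-correlation inequality `A³(½BAD(z) − τMG) ≤ ∫ e^{-π|ξ|²/A²}(1 − cos 2π⟨ξ,z⟩)|S_t|²`
(Aux 3); the modulation `1 − cos 2π⟨ξ,z⟩` vanishes on the periodised Bragg set
`K = {ξ : ξ + V ⊆ Z}` because `⟨ξ, z⟩ ∈ ℤ` there; off a `ρ`-neighbourhood of `K` and inside `|ξ| ≤ R`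
the test function is quiet (Aux 5, partition of unity + exact `V`-invariance); the Gaussian tail
`|ξ| > R` and the `ρ`-neighbourhood (where `1 − cos ≤ 2π²ρ²|z|²`) are dominated by
`∫ e^{-π|ξ|²/B²}|S_t|² ≤ B³(1+τ)MG` (Aux 3); choose `A`, then `R`, then `ρ`.) -/
theorem stub_essentialPeriodicityOfArith : ∀ (P : Literature.MathematicalPhysics.StatisticalMechanics.PeriodicConfiguration 3) (δ : ℝ), 0 < δ → ∀ Λ : Set (EuclideanSpace ℝ (Fin 3)), (∀ p ∈ Λ, ∀ q ∈ Λ, p ≠ q → δ ≤ dist p q) → ∀ M : Submodule ℤ (EuclideanSpace ℝ (Fin 3)), DiscreteTopology M → Λ ⊆ M → ∀ L : ℕ → ℝ, Filter.Tendsto L Filter.atTop Filter.atTop → (∀ g : EuclideanSpace ℝ (Fin 3) → ℝ, Continuous g → HasCompactSupport g → (∀ ξ ∈ tsupport g, ξ ≠ 0 ∧ ∀ k : EuclideanSpace ℝ (Fin 3), (∀ v ∈ P.lattice, ∃ n : ℤ, inner ℝ k v = (n : ℝ)) → ‖ξ‖ ≠ ‖k‖) → ∀ ε : ℝ, 0 <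 ε → ∀ᶠ t : ℕ in Filter.atTop, (∫ ξ, g ξ * ‖∑' s : Λ, (Real.exp (-(‖(s : EuclideanSpace ℝ (Fin 3))‖ ^ 2) / L t ^ 2) : ℂ) * Complex.exp (2 * Real.pi * Complex.I * (inner ℝ ξ (s : EuclideanSpace ℝ (Fin 3)) : ℂ))‖ ^ 2) ≤ ε * ∑' s : Λ, Real.exp (-(‖(s : EuclideanSpace ℝ (Fin 3))‖ ^ 2) / L t ^ 2) ^ 2) → ∀ V : Set (EuclideanSpace ℝ (Fin 3)), (∀ m ∈ V, ∀ s ∈ Λ, ∃ n : ℤ, inner ℝ m s = (n : ℝ)) → ∀ k : ℕ, 0 < k → (∀ ξ : EuclideanSpace ℝ (Fin 3), (∀ m ∈ V, ¬ (ξ + m ≠ 0 ∧ ∀ k' : EuclideanSpace ℝ (Fin 3), (∀ v ∈ P.lattice, ∃ n : ℤ, inner ℝ k' v = (n : ℝ)) → ‖ξ + m‖ ≠ ‖k'‖)) → ∀ z ∈ M, ∃ n : ℤ, (k : ℝ) * inner ℝ ξ z = (n : ℝ)) → ∃ (M' : Submodule ℤ (EuclideanSpace ℝ (Fin 3))) (k'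 : ℕ), 0 < k' ∧ M' ≤ M ∧ (∀ z ∈ M, (k' : ℤ) • z ∈ M') ∧ ∀ z ∈ M', Filter.Tendsto (fun t : ℕ => (∑' s : Λ, if (s : EuclideanSpace ℝ (Fin 3)) + z ∈ Λ then (0 : ℝ) else Real.exp (-(‖(s : EuclideanSpace ℝ (Fin 3))‖ ^ 2) / L t ^ 2) ^ 2) / ∑' s : Λ, Real.exp (-(‖(s : EuclideanSpace ℝ (Fin 3))‖ ^ 2) / L t ^ 2) ^ 2) Filter.atTop (nhds 0) :=
  Summit.AtomisticToContinuum.Crystallization.Theorems.stub_essentialPeriodicityOfArith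

/-- **STUB B2b — essential periodicity from a quiet spectrum on a commensurate lattice (route step
(B); classical content, XL formalisation effort).** For an hcp template with `h² = q a²`, a
`δ`-separated `Λ ∋ 0` inside a full-rank lattice `M` with `a²`-rational Gram matrix, Gaussian-quiet
(per Gaussian mass) off `{0} ∪` the Bragg spheres along scales `L_t → ∞`, is ESSENTIALLY PERIODIC
under a finite-index sublattice `M'` of `M`: along a sequence of scales `L'_t → ∞`, for every
`z ∈ M'` the Gaussian mass of the points `s ∈ Λ` with `s + z ∉ Λ` is `o(`total Gaussian mass`)`.
(Autocorrelation coefficients `ν_t(z) = Σ_{s,s+z∈Λ} w_t(s)w_t(s+z)/MG_t`, `z ∈ M`, converge along a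
subsequence; the limit functional `g ↦ lim (1/MG_t)∫ g|S_t|² = Σ_{z∈M} 𝓕⁻¹g(z) ν(z)` is positive,
EXACTLY `M*`-periodic (because `Λ ⊆ M`) and vanishes on admissible `g`, hence (partition of unity)
on `C_c` of the complement of `K = ⋂_{m*}(Z − m*)`, `Z = {0} ∪ spheres`; by the rational
arithmetic `K` lies in a lattice `c·M`, so the functional is a finite `M*`-periodic sum of point
masses and `ν` is a trigonometric polynomial with rational frequencies, `ν(0) = 1`, hence `ν = 1`
on the finite-index sublattice `M'` annihilating the frequencies; `ν_t(z) → 1` is the conclusion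
up to Gaussian bulk/tail bookkeeping.) -/
theorem stub_essentialPeriodicityRat : ∀ (a h : ℝ) (ha : a ≠ 0) (hh : h ≠ 0), (∃ q : ℚ, h ^ 2 = (q : ℝ) * a ^ 2) → ∀ δ : ℝ, 0 < δ → ∀ Λ : Set (EuclideanSpace ℝ (Fin 3)), (∀ p ∈ Λ, ∀ q ∈ Λ, p ≠ q → δ ≤ dist p q) → (0 : EuclideanSpace ℝ (Fin 3)) ∈ Λ → ∀ M : Submodule ℤ (EuclideanSpace ℝ (Fin 3)), DiscreteTopology M → Submodule.span ℝ (M : Set (EuclideanSpace ℝ (Fin 3))) = ⊤ → (∃ D : ℕ, 0 < D ∧ ∀ u ∈ M, ∀ v ∈ M, ∃ n : ℤ, (D : ℝ) * inner ℝ u v = (n : ℝ) * a ^ 2) → Λ ⊆ M → (∃ L : ℕ → ℝ, Filter.Tendsto L Filter.atTop Filter.atTop ∧ ∀ g : EuclideanSpace ℝ (Fin 3) → ℝ, Continuous g → HasCompactSupport g → (∀ ξ ∈ tsupport g, ξ ≠ 0 ∧ ∀ k : EuclideanSpace ℝ (Fin 3), (∀ v ∈ (Literature.MathematicalPhysics.StatisticalMechanics.hcpPeriodicConfiguration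 ha hh).lattice, ∃ n : ℤ, inner ℝ k v = (n : ℝ)) → ‖ξ‖ ≠ ‖k‖) → ∀ ε : ℝ, 0 < ε → ∀ᶠ t : ℕ in Filter.atTop, (∫ ξ, g ξ * ‖∑' s : Λ, (Real.exp (-(‖(s : EuclideanSpace ℝ (Fin 3))‖ ^ 2) / L t ^ 2) : ℂ) * Complex.exp (2 * Real.pi * Complex.I * (inner ℝ ξ (s : EuclideanSpace ℝ (Fin 3)) : ℂ))‖ ^ 2) ≤ ε * ∑' s : Λ, Real.exp (-(‖(s : EuclideanSpace ℝ (Fin 3))‖ ^ 2) / L t ^ 2) ^ 2) → ∃ (M' : Submodule ℤ (EuclideanSpace ℝ (Fin 3))) (k : ℕ), 0 < k ∧ M' ≤ M ∧ (∀ z ∈ M, (k : ℤ) • z ∈ M') ∧ (∃ L' : ℕ → ℝ, Filter.Tendsto L' Filter.atTop Filter.atTop ∧ ∀ z ∈ M', Filter.Tendsto (fun t : ℕ => (∑' s : Λ, if (s : EuclideanSpace ℝ (Fin 3)) + z ∈ Λ then (0 : ℝ) else Real.exp (-(‖(s : EuclideanSpace ℝ (Fin 3))‖ ^ 2) / L'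 t ^ 2) ^ 2) / ∑' s : Λ, Real.exp (-(‖(s : EuclideanSpace ℝ (Fin 3))‖ ^ 2) / L' t ^ 2) ^ 2) Filter.atTop (nhds 0)) :=
  Summit.AtomisticToContinuum.Crystallization.Theorems.stub_essentialPeriodicityRat

/-- **STUB B2b' — periodic windows from essential periodicity (bookkeeping + pigeonhole; size M).**
A `δ`-separated `Λ ∋ 0` inside a full-rank lattice `M`, essentially periodic (in Gaussian mass,
along scales `L'_t → ∞`) under a finite-index sublattice `M'`, has for every radius a translated
window two-way matched (indeed equal) with ONE periodic configuration `Q` with lattice `M'`.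
(For fixed `R` the Gaussian mass of centres `s₀ ∈ Λ` whose `R`-window is not `M'`-complete for the
finitely many `z ∈ M' ∩ B(0, 2R+1)` is `o(MG_t)` (weights of points within `R` of each other are
comparable in the Gaussian bulk `‖s‖ ≤ A L'_t`, the tail beyond is negligible), so complete windows
exist; a complete window is `(F + M') ∩ B_R` for the finite set `F ⊆ M/M'` of classes it meets;
finitely many possible `F`, so one serves infinitely many radii (pigeonhole), hence all.) -/
theorem stub_windowsOfEssentialPeriodicity : ∀ δ : ℝ, 0 < δ → ∀ Λ : Set (EuclideanSpace ℝ (Fin 3)), (∀ p ∈ Λ, ∀ q ∈ Λ, p ≠ q → δ ≤ dist p q) → (0 : EuclideanSpace ℝ (Fin 3)) ∈ Λ → ∀ M : Submodule ℤ (EuclideanSpace ℝ (Fin 3)), DiscreteTopology M → Submodule.span ℝ (M : Set (EuclideanSpace ℝ (Fin 3))) = ⊤ → Λ ⊆ M → ∀ (M' : Submodule ℤ (EuclideanSpace ℝ (Fin 3))) (k : ℕ), 0 < k → M' ≤ M → (∀ z ∈ M, (k : ℤ) • z ∈ M') → (∃ L' : ℕ → ℝ, Filter.Tendsto L' Filter.atTop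 Filter.atTop ∧ ∀ z ∈ M', Filter.Tendsto (fun t : ℕ => (∑' s : Λ, if (s : EuclideanSpace ℝ (Fin 3)) + z ∈ Λ then (0 : ℝ) else Real.exp (-(‖(s : EuclideanSpace ℝ (Fin 3))‖ ^ 2) / L' t ^ 2) ^ 2) / ∑' s : Λ, Real.exp (-(‖(s : EuclideanSpace ℝ (Fin 3))‖ ^ 2) / L' t ^ 2) ^ 2) Filter.atTop (nhds 0)) → ∃ Q : Literature.MathematicalPhysics.StatisticalMechanics.PeriodicConfiguration 3, ∀ R ε : ℝ, 0 < ε → ∃ c : EuclideanSpace ℝ (Fin 3), (∀ s ∈ Q.points, ‖s‖ ≤ R → ∃ p ∈ Λ, dist (p - c) s ≤ ε) ∧ (∀ p ∈ Λ, ‖p - c‖ ≤ R → ∃ s ∈ Q.points, dist (p - c) s ≤ ε) :=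
  Summit.AtomisticToContinuum.Crystallization.Theorems.stub_windowsOfEssentialPeriodicity

/-- **STUB B2c₁ₐ′ — THE RESEARCH KERNEL: an essential period lattice from quietness, ALGEBRAIC
incommensurate case (`h²/a²` algebraic irrational; XL, no known route).** A `δ`-separated `Λ ∋ 0`
all of whose pair distances are hcp template distances and whose Gaussian windows are quiet off the
Bragg set has an essential period lattice `N ⊆ Λ − Λ`, `k • Λ ⊆ N`.  (The transcendental case is
the landed `stub_essentialPeriodLatticeTransc`; its Gram-pencil confinement needs no rational
polynomial of degree `≤ 4` to vanish at `t = h²/a²` and its dual arithmetic needs `t⁻¹, 1, t`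
ℚ-independent, so the genuinely open core is `t` algebraic of degree 2, 3, 4 — everything "folds
inside ℚ(t)".  Distances alone do not suffice (finite clusters, thin Pell bilayers); quietness must
produce richness (columns/patches) before square-growth along progressions forces layer
functionals.  See `Lines/registered-kernel.md`.) -/
theorem stub_essentialPeriodLatticeAlg : ∀ (a h : ℝ) (ha : a ≠ 0) (hh : h ≠ 0), ¬ (∃ q : ℚ, h ^ 2 = (q : ℝ) * a ^ 2) → IsAlgebraic ℚ (h ^ 2 / a ^ 2) → ∀ δ : ℝ, 0 < δ → ∀ Λ : Set (EuclideanSpace ℝ (Fin 3)), (∀ p ∈ Λ, ∀ q ∈ Λ, p ≠ q → δ ≤ dist p q) → (0 : EuclideanSpace ℝ (Fin 3)) ∈ Λ → (∀ p ∈ Λ, ∀ q ∈ Λ, ∃ a' ∈ (Literature.MathematicalPhysics.StatisticalMechanics.hcpPeriodicConfiguration ha hh).points, ∃ b' ∈ (Literature.MathematicalPhysics.StatisticalMechanics.hcpPeriodicConfiguration ha hh).points, dist p q = dist a' b') → (∃ L : ℕ → ℝ, Filter.Tendsto L Filter.atTop Filter.atTop ∧ ∀ g : EuclideanSpace ℝ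 (Fin 3) → ℝ, Continuous g → HasCompactSupport g → (∀ ξ ∈ tsupport g, ξ ≠ 0 ∧ ∀ k : EuclideanSpace ℝ (Fin 3), (∀ v ∈ (Literature.MathematicalPhysics.StatisticalMechanics.hcpPeriodicConfiguration ha hh).lattice, ∃ n : ℤ, inner ℝ k v = (n : ℝ)) → ‖ξ‖ ≠ ‖k‖) → ∀ ε : ℝ, 0 < ε → ∀ᶠ t : ℕ in Filter.atTop, (∫ ξ, g ξ * ‖∑' s : Λ, (Real.exp (-(‖(s : EuclideanSpace ℝ (Fin 3))‖ ^ 2) / L t ^ 2) : ℂ) * Complex.exp (2 * Real.pi * Complex.I * (inner ℝ ξ (s : EuclideanSpace ℝ (Fin 3)) : ℂ))‖ ^ 2) ≤ ε * ∑' s : Λ, Real.exp (-(‖(s : EuclideanSpace ℝ (Fin 3))‖ ^ 2) / L t ^ 2) ^ 2) → ∃ (N : Submodule ℤ (EuclideanSpace ℝ (Fin 3))) (k : ℕ), DiscreteTopology N ∧ Submodule.span ℝ (N : Set (EuclideanSpace ℝ (Fin 3))) = ⊤ ∧ 0 < k ∧ (∀ z ∈ N, ∃ p ∈ Λ, ∃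 q ∈ Λ, z = p - q) ∧ (∀ p ∈ Λ, (k : ℤ) • p ∈ N) := by
  sorry

/-- **B2c₁ₐ (former registered stub, now GLUE): the essential period lattice, incommensurate case** —
by cases on `Transcendental ℚ (h²/a²)`: the landed transcendental theorem, or the algebraic kernel. -/
theorem stub_essentialPeriodLattice : ∀ (a h : ℝ) (ha : a ≠ 0) (hh : h ≠ 0), ¬ (∃ q : ℚ, h ^ 2 = (q : ℝ) * a ^ 2) → ∀ δ : ℝ, 0 < δ → ∀ Λ : Set (EuclideanSpace ℝ (Fin 3)), (∀ p ∈ Λ, ∀ q ∈ Λ, p ≠ q → δ ≤ dist p q) → (0 : EuclideanSpace ℝ (Fin 3)) ∈ Λ → (∀ p ∈ Λ, ∀ q ∈ Λ, ∃ a' ∈ (Literature.MathematicalPhysics.StatisticalMechanics.hcpPeriodicConfiguration ha hh).points, ∃ b' ∈ (Literature.MathematicalPhysics.StatisticalMechanics.hcpPeriodicConfiguration ha hh).points, dist p q = dist a' b') → (∃ L : ℕ → ℝ, Filter.Tendsto L Filter.atTop Filter.atTop ∧ ∀ g : EuclideanSpace ℝ (Fin 3) → ℝ, Continuous g → HasCompactSupport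 g → (∀ ξ ∈ tsupport g, ξ ≠ 0 ∧ ∀ k : EuclideanSpace ℝ (Fin 3), (∀ v ∈ (Literature.MathematicalPhysics.StatisticalMechanics.hcpPeriodicConfiguration ha hh).lattice, ∃ n : ℤ, inner ℝ k v = (n : ℝ)) → ‖ξ‖ ≠ ‖k‖) → ∀ ε : ℝ, 0 < ε → ∀ᶠ t : ℕ in Filter.atTop, (∫ ξ, g ξ * ‖∑' s : Λ, (Real.exp (-(‖(s : EuclideanSpace ℝ (Fin 3))‖ ^ 2) / L t ^ 2) : ℂ) * Complex.exp (2 * Real.pi * Complex.I * (inner ℝ ξ (s : EuclideanSpace ℝ (Fin 3)) : ℂ))‖ ^ 2) ≤ ε * ∑' s : Λ, Real.exp (-(‖(s : EuclideanSpace ℝ (Fin 3))‖ ^ 2) / L t ^ 2) ^ 2) → ∃ (N : Submodule ℤ (EuclideanSpace ℝ (Fin 3))) (k : ℕ), DiscreteTopology N ∧ Submodule.span ℝ (N : Set (EuclideanSpace ℝ (Fin 3))) = ⊤ ∧ 0 < k ∧ (∀ z ∈ N, ∃ p ∈ Λ, ∃ q ∈ Λ, z = p - q) ∧ (∀ p ∈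 Λ, (k : ℤ) • p ∈ N) := by
  intro a h ha hh hq δ hδ Λ hsep h0 hE hQ
  by_cases ht : Transcendental ℚ (h ^ 2 / a ^ 2)
  · exact Summit.AtomisticToContinuum.Crystallization.Theorems.stub_essentialPeriodLatticeTransc a h ha hh ht
      δ hδ Λ hsep h0 hE hQ
  · exact stub_essentialPeriodLatticeAlg a h ha hh hq (not_not.mp ht) δ hδ Λ hsep h0 hE hQ

/-- **STUB B2c₁ᵦ — the template-lattice split (incommensurate case; elementary arithmetic,
size L).** A discrete full-rank `ℤ`-module `N` of `ℝ³` ALL of whose vectors have hcp template lengths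
(`h²/a² ∉ ℚ`) is split: `N ⊆ M₂ ⊕ ℤv` up to the index `k` (`k•p ∈ N ⇒ p ∈ M₂ ⊕ ℤv`), with
`M₂ ⊥ v`, `D⟨u,w⟩ ∈ a²ℤ` on `M₂`, `D|v|² ∈ h²ℤ`, `M₂ ⊕ ℤv` discrete of full rank.  (`|z|² = a²ℓ + h²m²`
uniquely, so `Q = A + (h²/a²)H` with rational forms on `N`; `H(z) = m²` on ALL of `N` forces
`H = λ²` for an additive `λ : N → ℤ` (discriminants of square-valued binary forms vanish); `λ ≠ 0`
and `A(v,v) = 0` on the `Q`-orthogonal complement of `ker λ` by the 2-adic structure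
`ℓ ∈ {4ᵏ·odd/9} ∪ {0}` of Loeschian values; then rescale by `1/k`.  Ingredients proved in the
harvest file `work/stubs/LayeredConfinementIrrat.lean`.) -/
theorem stub_templateLatticeSplit : ∀ (a h : ℝ) (ha : a ≠ 0) (hh : h ≠ 0), ¬ (∃ q : ℚ, h ^ 2 = (q : ℝ) * a ^ 2) → ∀ N : Submodule ℤ (EuclideanSpace ℝ (Fin 3)), DiscreteTopology N → Submodule.span ℝ (N : Set (EuclideanSpace ℝ (Fin 3))) = ⊤ → (∀ z ∈ N, ∃ a' ∈ (Literature.MathematicalPhysics.StatisticalMechanics.hcpPeriodicConfiguration ha hh).points, ∃ b' ∈ (Literature.MathematicalPhysics.StatisticalMechanics.hcpPeriodicConfiguration ha hh).points, ‖z‖ = dist a' b') → ∀ k : ℕ, 0 < k → ∃ (M₂ : Submodule ℤ (EuclideanSpace ℝ (Fin 3))) (v : EuclideanSpace ℝ (Fin 3)) (D : ℕ), 0 < D ∧ v ≠ 0 ∧ (∀ u ∈ M₂, inner ℝ u v = 0) ∧ (∀ u ∈ M₂, ∀ w ∈ M₂, ∃ n : ℤ, (D : ℝ) * inner ℝ u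 w = (n : ℝ) * a ^ 2) ∧ (∃ n : ℤ, (D : ℝ) * ‖v‖ ^ 2 = (n : ℝ) * h ^ 2) ∧ DiscreteTopology ↥(M₂ ⊔ Submodule.span ℤ {v}) ∧ Submodule.span ℝ ((M₂ ⊔ Submodule.span ℤ {v} : Submodule ℤ (EuclideanSpace ℝ (Fin 3))) : Set (EuclideanSpace ℝ (Fin 3))) = ⊤ ∧ ∀ p : EuclideanSpace ℝ (Fin 3), (k : ℤ) • p ∈ N → p ∈ M₂ ⊔ Submodule.span ℤ {v} :=
  Summit.AtomisticToContinuum.Crystallization.Theorems.stub_templateLatticeSplit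

/-- **B2c₁ (former registered stub, now GLUE over B2c₁ₐ and B2c₁ᵦ): layered lattice confinement,
incommensurate case.** The essential period lattice `N ⊆ Λ − Λ`, `k•Λ ⊆ N` (B2c₁ₐ) consists of
template-length vectors, so it is split up to the index `k` (B2c₁ᵦ), and `Λ` lies in the split
lattice. -/
theorem stub_layeredConfinementIrrat : ∀ (a h : ℝ) (ha : a ≠ 0) (hh : h ≠ 0), ¬ (∃ q : ℚ, h ^ 2 = (q : ℝ) * a ^ 2) → ∀ δ : ℝ, 0 < δ → ∀ Λ : Set (EuclideanSpace ℝ (Fin 3)), (∀ p ∈ Λ, ∀ q ∈ Λ, p ≠ q → δ ≤ dist p q) → (0 : EuclideanSpace ℝ (Fin 3)) ∈ Λ → (∀ p ∈ Λ, ∀ q ∈ Λ, ∃ a' ∈ (Literature.MathematicalPhysics.StatisticalMechanics.hcpPeriodicConfiguration ha hh).points, ∃ b' ∈ (Literature.MathematicalPhysics.StatisticalMechanics.hcpPeriodicConfiguration ha hh).points, dist p q = dist a' b') → (∃ L : ℕ → ℝ, Filter.Tendsto L Filter.atTop Filter.atTop ∧ ∀ g : EuclideanSpace ℝ (Fin 3)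 → ℝ, Continuous g → HasCompactSupport g → (∀ ξ ∈ tsupport g, ξ ≠ 0 ∧ ∀ k : EuclideanSpace ℝ (Fin 3), (∀ v ∈ (Literature.MathematicalPhysics.StatisticalMechanics.hcpPeriodicConfiguration ha hh).lattice, ∃ n : ℤ, inner ℝ k v = (n : ℝ)) → ‖ξ‖ ≠ ‖k‖) → ∀ ε : ℝ, 0 < ε → ∀ᶠ t : ℕ in Filter.atTop, (∫ ξ, g ξ * ‖∑' s : Λ, (Real.exp (-(‖(s : EuclideanSpace ℝ (Fin 3))‖ ^ 2) / L t ^ 2) : ℂ) * Complex.exp (2 * Real.pi * Complex.I * (inner ℝ ξ (s : EuclideanSpace ℝ (Fin 3)) : ℂ))‖ ^ 2) ≤ ε * ∑' s : Λ, Real.exp (-(‖(s : EuclideanSpace ℝ (Fin 3))‖ ^ 2) / L t ^ 2) ^ 2) → ∃ (M₂ : Submodule ℤ (EuclideanSpace ℝ (Fin 3))) (v : EuclideanSpace ℝ (Fin 3)) (D : ℕ), 0 < D ∧ v ≠ 0 ∧ (∀ u ∈ M₂, inner ℝ u v = 0) ∧ (∀ u ∈ M₂, ∀ w ∈ M₂,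 ∃ n : ℤ, (D : ℝ) * inner ℝ u w = (n : ℝ) * a ^ 2) ∧ (∃ n : ℤ, (D : ℝ) * ‖v‖ ^ 2 = (n : ℝ) * h ^ 2) ∧ DiscreteTopology ↥(M₂ ⊔ Submodule.span ℤ {v}) ∧ Submodule.span ℝ ((M₂ ⊔ Submodule.span ℤ {v} : Submodule ℤ (EuclideanSpace ℝ (Fin 3))) : Set (EuclideanSpace ℝ (Fin 3))) = ⊤ ∧ Λ ⊆ ↑(M₂ ⊔ Submodule.span ℤ {v}) := by
  intro a h ha hh hq δ hδ Λ hsep h0 hE hQ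
  obtain ⟨N, k, hNd, hNspan, hk, hNdiff, hkΛ⟩ :=
    stub_essentialPeriodLattice a h ha hh hq δ hδ Λ hsep h0 hE hQ
  have hNlen : ∀ z ∈ N, ∃ a' ∈ (Literature.MathematicalPhysics.StatisticalMechanics.hcpPeriodicConfiguration ha hh).points,
      ∃ b' ∈ (Literature.MathematicalPhysics.StatisticalMechanics.hcpPeriodicConfiguration ha hh).points,
        ‖z‖ = dist a' b' := by
    intro z hz
    obtain ⟨p, hp, q, hq', rfl⟩ := hNdiff z hz
    obtain ⟨a', ha', b', hb', hd⟩ := hE p hp q hq'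
    exact ⟨a', ha', b', hb', by rw [← dist_eq_norm, hd]⟩
  obtain ⟨M₂, v, D, hD, hv, hperp, hgram, hvv, hdisc, hspan, hmem⟩ :=
    stub_templateLatticeSplit a h ha hh hq N hNd hNspan hNlen k hk
  exact ⟨M₂, v, D, hD, hv, hperp, hgram, hvv, hdisc, hspan, fun p hp => hmem p (hkΛ p hp)⟩

/-- **STUB B2c₂ — the split arithmetic lemma (incommensurate case; elementary, size M).** For the
hcp template with `h²/a² ∉ ℚ`, a `ℤ`-module `M₂ ⊥ v` with `D⟨u,w⟩ ∈ a²ℤ` on `M₂` and `D|v|² ∈ h²ℤ`: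
if `ξ + (D/a²)b + (Dj/h²)v` lies in the Bragg set `{0} ∪ ⋃_{k ∈ L*} {|η| = |k|}` for all `b ∈ M₂`,
`j ∈ ℤ`, then `24D⟨ξ, z + jv⟩ ∈ ℤ` for all `z ∈ M₂`, `j ∈ ℤ`.  (Every dual vector has
`|k|² = N/(3a²) + N'/(4h²)` with `N, N' ∈ ℕ`; since `1/a², 1/h²` are `ℚ`-independent the two
components of `|ξ + m|²` are well defined, NON-NEGATIVE, and affine in the multiple `j ↦ jm`; an
affine function on `ℤ` with values `≥ 0` is constant, which kills the cross components and leaves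
`2D⟨ξ,b⟩ ∈ (1/3)ℤ`, `2D⟨ξ,v⟩ ∈ (1/4)ℤ`.) -/
theorem stub_essentialPeriodicityIrratArith : ∀ (a h : ℝ) (ha : a ≠ 0) (hh : h ≠ 0), ¬ (∃ q : ℚ, h ^ 2 = (q : ℝ) * a ^ 2) → ∀ (M₂ : Submodule ℤ (EuclideanSpace ℝ (Fin 3))) (v : EuclideanSpace ℝ (Fin 3)) (D : ℕ), 0 < D → (∀ u ∈ M₂, inner ℝ u v = 0) → (∀ u ∈ M₂, ∀ w ∈ M₂, ∃ n : ℤ, (D : ℝ) * inner ℝ u w = (n : ℝ) * a ^ 2) → (∃ n : ℤ, (D : ℝ) * ‖v‖ ^ 2 = (n : ℝ) * h ^ 2) → ∀ ξ : EuclideanSpace ℝ (Fin 3), (∀ b ∈ M₂, ∀ j : ℤ, ¬ (ξ + ((D : ℝ) / a ^ 2) • b + ((D : ℝ) * (j : ℝ) / h ^ 2) • v ≠ 0 ∧ ∀ k : EuclideanSpace ℝ (Fin 3), (∀ g ∈ (Literature.MathematicalPhysics.StatisticalMechanics.hcpPeriodicConfiguration ha hh).lattice, ∃ n : ℤ, inner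 ℝ k g = (n : ℝ)) → ‖ξ + ((D : ℝ) / a ^ 2) • b + ((D : ℝ) * (j : ℝ) / h ^ 2) • v‖ ≠ ‖k‖)) → ∀ z ∈ M₂, ∀ j : ℤ, ∃ n : ℤ, ((24 * D : ℕ) : ℝ) * inner ℝ ξ (z + (j : ℝ) • v) = (n : ℝ) :=
  Summit.AtomisticToContinuum.Crystallization.Theorems.stub_essentialPeriodicityIrratArith

/-! ### Glue for the incommensurate case -/

/-- Membership in `M₂ ⊔ ℤv`: `z = z₂ + j • v`. -/
theorem mem_sup_span_singleton {M₂ : Submodule ℤ (EuclideanSpace ℝ (Fin 3))} {v z : EuclideanSpace ℝ (Fin 3)}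
    (hz : z ∈ M₂ ⊔ Submodule.span ℤ {v}) : ∃ z₂ ∈ M₂, ∃ j : ℤ, z = z₂ + (j : ℝ) • v := by
  obtain ⟨z₂, hz₂, w, hw, rfl⟩ := Submodule.mem_sup.1 hz
  obtain ⟨j, rfl⟩ := Submodule.mem_span_singleton.1 hw
  exact ⟨z₂, hz₂, j, by rw [Int.cast_smul_eq_zsmul]⟩

/-- **B2c (former registered stub, now GLUE over B2c₁, B2c₂, B2b₀ and B2b'): rigidity of one
quiet exact limit set, incommensurate case.** Layered confinement `Λ ⊆ M = M₂ ⊕ ℤv` (B2c₁); the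
periods `V = (D/a²)M₂ + (D/h²)ℤv` of `|S_t|²` and the split arithmetic lemma (B2c₂) feed the generic
essential-periodicity theorem (B2b₀) with `k = 24D`; periodic windows by B2b'. -/
theorem stub_limitRigidityIrrat : ∀ (a h : ℝ) (ha : a ≠ 0) (hh : h ≠ 0), ¬ (∃ q : ℚ, h ^ 2 = (q : ℝ) * a ^ 2) → ∀ δ : ℝ, 0 < δ → ∀ Λ : Set (EuclideanSpace ℝ (Fin 3)), (∀ p ∈ Λ, ∀ q ∈ Λ, p ≠ q → δ ≤ dist p q) → (0 : EuclideanSpace ℝ (Fin 3)) ∈ Λ → (∀ p ∈ Λ, ∀ q ∈ Λ, ∃ a' ∈ (Literature.MathematicalPhysics.StatisticalMechanics.hcpPeriodicConfiguration ha hh).points, ∃ b' ∈ (Literature.MathematicalPhysics.StatisticalMechanics.hcpPeriodicConfiguration ha hh).points, dist p q = dist a' b') → (∃ L : ℕ → ℝ, Filter.Tendsto L Filter.atTop Filter.atTop ∧ ∀ g : EuclideanSpace ℝ (Fin 3) → ℝ, Continuous g → HasCompactSupport g → (∀ ξ ∈ tsupport g, ξ ≠ 0 ∧ ∀ k : EuclideanSpace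 ℝ (Fin 3), (∀ v ∈ (Literature.MathematicalPhysics.StatisticalMechanics.hcpPeriodicConfiguration ha hh).lattice, ∃ n : ℤ, inner ℝ k v = (n : ℝ)) → ‖ξ‖ ≠ ‖k‖) → ∀ ε : ℝ, 0 < ε → ∀ᶠ t : ℕ in Filter.atTop, (∫ ξ, g ξ * ‖∑' s : Λ, (Real.exp (-(‖(s : EuclideanSpace ℝ (Fin 3))‖ ^ 2) / L t ^ 2) : ℂ) * Complex.exp (2 * Real.pi * Complex.I * (inner ℝ ξ (s : EuclideanSpace ℝ (Fin 3)) : ℂ))‖ ^ 2) ≤ ε * ∑' s : Λ, Real.exp (-(‖(s : EuclideanSpace ℝ (Fin 3))‖ ^ 2) / L t ^ 2) ^ 2) → ∃ Q : Literature.MathematicalPhysics.StatisticalMechanics.PeriodicConfiguration 3, ∀ R ε : ℝ, 0 < ε → ∃ c : EuclideanSpace ℝ (Fin 3), (∀ s ∈ Q.points, ‖s‖ ≤ R → ∃ p ∈ Λ, dist (p - c) s ≤ ε) ∧ (∀ p ∈ Λ, ‖p - c‖ ≤ R → ∃ s ∈ Q.points, dist (p - c) s ≤ ε) := by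
  intro a h ha hh hq δ hδ Λ hsep h0 hE hQ
  obtain ⟨M₂, v, D, hD, hv, hperp, hgram, hvv, hdisc, hspan, hΛM⟩ :=
    stub_layeredConfinementIrrat a h ha hh hq δ hδ Λ hsep h0 hE hQ
  obtain ⟨L, hL, hquiet⟩ := hQ
  haveI := hdisc
  set M : Submodule ℤ (EuclideanSpace ℝ (Fin 3)) := M₂ ⊔ Submodule.span ℤ {v} with hMdef
  -- the periods of `|S_t|²`
  set V : Set (EuclideanSpace ℝ (Fin 3)) := {m | ∃ b ∈ M₂, ∃ j : ℤ,
    m = ((D : ℝ) / a ^ 2) • b + ((D : ℝ) * (j : ℝ) / h ^ 2) • v} with hVdef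
  obtain ⟨nv, hnv⟩ := hvv
  have ha2 : a ^ 2 ≠ 0 := pow_ne_zero 2 ha
  have hh2 : h ^ 2 ≠ 0 := pow_ne_zero 2 hh
  have hV : ∀ m ∈ V, ∀ s ∈ Λ, ∃ n : ℤ, inner ℝ m s = (n : ℝ) := by
    rintro m ⟨b, hb, j, rfl⟩ s hs
    obtain ⟨s₂, hs₂, j', hs'⟩ := mem_sup_span_singleton (hΛM hs)
    obtain ⟨n₁, hn₁⟩ := hgram b hb s₂ hs₂
    refine ⟨n₁ + j * j' * nv, ?_⟩
    have h1 : inner ℝ b v = 0 := hperp b hb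
    have h2 : inner ℝ v s₂ = 0 := by rw [real_inner_comm]; exact hperp s₂ hs₂
    have h3 : inner ℝ v v = ‖v‖ ^ 2 := real_inner_self_eq_norm_sq v
    rw [hs']
    simp only [inner_add_left, inner_add_right, real_inner_smul_left, real_inner_smul_right, h1, h2,
      h3, mul_zero, add_zero, zero_add]
    push_cast
    field_simp
    linear_combination h ^ 2 * hn₁ + (j : ℝ) * (j' : ℝ) * a ^ 2 * hnv
  -- the arithmetic input with `k = 24 D`
  have hk : 0 < 24 * D := by positivity
  have harith : ∀ ξ : EuclideanSpace ℝ (Fin 3), (∀ m ∈ V, ¬ (ξ + m ≠ 0 ∧ ∀ k' : EuclideanSpace ℝ (Fin 3),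
      (∀ v ∈ (Literature.MathematicalPhysics.StatisticalMechanics.hcpPeriodicConfiguration ha hh).lattice,
        ∃ n : ℤ, inner ℝ k' v = (n : ℝ)) → ‖ξ + m‖ ≠ ‖k'‖)) →
      ∀ z ∈ M, ∃ n : ℤ, ((24 * D : ℕ) : ℝ) * inner ℝ ξ z = (n : ℝ) := by
    intro ξ hξ z hz
    obtain ⟨z₂, hz₂, j, rfl⟩ := mem_sup_span_singleton hz
    refine stub_essentialPeriodicityIrratArith a h ha hh hq M₂ v D hD hperp hgram ⟨nv, hnv⟩ ξ
      (fun b hb j' => ?_) z₂ hz₂ j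
    have := hξ (((D : ℝ) / a ^ 2) • b + ((D : ℝ) * (j' : ℝ) / h ^ 2) • v) ⟨b, hb, j', rfl⟩
    rwa [← add_assoc] at this
  obtain ⟨M', k', hk', hM'M, hkM, hess⟩ :=
    stub_essentialPeriodicityOfArith _ δ hδ Λ hsep M hdisc hΛM L hL hquiet V hV (24 * D) hk harith
  exact stub_windowsOfEssentialPeriodicity δ hδ Λ hsep h0 M hdisc hspan hΛM M' k' hk' hM'M hkM
    ⟨L, hL, hess⟩

/-- **B2 (former registered stub, now GLUE over B2a, B2b, B2b', B2c): rigidity of one quiet exact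
limit set (hcp-relative "spherical Lev–Olevskii").** For an hcp template `P = hcpPeriodicConfiguration a h` and a `δ`-separated
set `Λ ∋ 0` in `ℝ³` all of whose pair distances are template distances (`Λ − Λ` has norms in
`D_P`) and whose Gaussian-windowed structure factor, per unit Gaussian mass, vanishes
asymptotically off `{0} ∪` the Bragg spheres of `P` along a sequence of scales `L_t → ∞`, there is
ONE periodic configuration `Q` such that for every radius `R` and `ε > 0` some translate of `Λ`
is two-way `ε`-matched with `Q` on the ball of radius `R`.  (Route steps (A): Gram integrality for
`h²/a² ∈ ℚ`, layered confinement + Anning–Erdős for `h²/a² ∉ ℚ`, confine `Λ − Λ` to a lattice `M`;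
(B): the autocorrelation of `Λ` lives on `M`, its transform is `M*`-periodic and carried by
`{0} ∪` spheres, hence uniformly discrete, hence a finite trigonometric polynomial; `Λ` is periodic
off density zero; clean windows exist at all radii.) -/
theorem stub_limitRigidity : ∀ (P : Literature.MathematicalPhysics.StatisticalMechanics.PeriodicConfiguration 3), (∃ (a h : ℝ) (ha : a ≠ 0) (hh : h ≠ 0), P = Literature.MathematicalPhysics.StatisticalMechanics.hcpPeriodicConfiguration ha hh) → ∀ δ : ℝ, 0 < δ → ∀ Λ : Set (EuclideanSpace ℝ (Fin 3)), (∀ p ∈ Λ, ∀ q ∈ Λ, p ≠ q → δ ≤ dist p q) → (0 : EuclideanSpace ℝ (Fin 3)) ∈ Λ → (∀ p ∈ Λ, ∀ q ∈ Λ, ∃ a ∈ P.points, ∃ b ∈ P.points, dist p q = dist a b) → (∃ L : ℕ → ℝ, Filter.Tendsto L Filter.atTop Filter.atTop ∧ ∀ h : EuclideanSpace ℝ (Fin 3) → ℝ, Continuous h → HasCompactSupport h → (∀ ξ ∈ tsupport h, ξ ≠ 0 ∧ ∀ k : EuclideanSpace ℝ (Fin 3), (∀ g ∈ P.lattice, ∃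 n : ℤ, inner ℝ k g = (n : ℝ)) → ‖ξ‖ ≠ ‖k‖) → ∀ ε : ℝ, 0 < ε → ∀ᶠ t : ℕ in Filter.atTop, (∫ ξ, h ξ * ‖∑' s : Λ, (Real.exp (-(‖(s : EuclideanSpace ℝ (Fin 3))‖ ^ 2) / L t ^ 2) : ℂ) * Complex.exp (2 * Real.pi * Complex.I * (inner ℝ ξ (s : EuclideanSpace ℝ (Fin 3)) : ℂ))‖ ^ 2) ≤ ε * ∑' s : Λ, Real.exp (-(‖(s : EuclideanSpace ℝ (Fin 3))‖ ^ 2) / L t ^ 2) ^ 2) → ∃ Q : Literature.MathematicalPhysics.StatisticalMechanics.PeriodicConfiguration 3, ∀ R ε : ℝ, 0 < ε → ∃ c : EuclideanSpace ℝ (Fin 3), (∀ s ∈ Q.points, ‖s‖ ≤ R → ∃ p ∈ Λ, dist (p - c) s ≤ ε) ∧ (∀ p ∈ Λ, ‖p - c‖ ≤ R → ∃ s ∈ Q.points, dist (p - c) s ≤ ε) := by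
  intro P hP δ hδ Λ hsep h0 hE hQ
  obtain ⟨a, h, ha, hh, rfl⟩ := hP
  by_cases hq : ∃ q : ℚ, h ^ 2 = (q : ℝ) * a ^ 2
  · obtain ⟨M, hMd, hMspan, hMgram, hΛM⟩ := stub_latticeConfinementRat a h ha hh hq Λ h0 hE
    obtain ⟨M', k, hk, hM'M, hkM, hess⟩ :=
      stub_essentialPeriodicityRat a h ha hh hq δ hδ Λ hsep h0 M hMd hMspan hMgram hΛM hQ
    exact stub_windowsOfEssentialPeriodicity δ hδ Λ hsep h0 M hMd hMspan hΛM M' k hk hM'M hkM hess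
  · exact stub_limitRigidityIrrat a h ha hh hq δ hδ Λ hsep h0 hE hQ

/-- **STUB B3 — windows return to the finite configurations (bookkeeping).** If finite
configurations `z_k` converge locally to a set `Λ` (two-way `ε`-matching on every ball about `0`,
eventually in `k`) and `Λ` has, for every radius and tolerance, a translated window two-way matched
with the point set of a periodic configuration `Q`, then along a subsequence and after
re-translations the `z_k` are eventually two-way `ε`-matched with `Q` on every ball.  (Stage `k`:
radius `k`, tolerance `1/(k+1)`, window centre `c_k`; local convergence at radius `‖c_k‖ + k + 1`.) -/
theorem stub_windowsReturn : ∀ (m : ℕ → ℕ) (z : (k : ℕ) → (Fin (m k) → EuclideanSpace ℝ (Fin 3))) (Λ : Set (EuclideanSpace ℝ (Fin 3))) (Q : Literature.MathematicalPhysics.StatisticalMechanics.PeriodicConfiguration 3), (∀ R ε : ℝ, 0 < ε → ∀ᶠ k : ℕ in Filter.atTop, (∀ p ∈ Λ, ‖p‖ ≤ R → ∃ i : Fin (m k), dist (z k i) p ≤ ε) ∧ (∀ i : Fin (m k), ‖z k i‖ ≤ R → ∃ p ∈ Λ, dist (z k i) p ≤ ε)) → (∀ R ε : ℝ, 0 <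 ε → ∃ c : EuclideanSpace ℝ (Fin 3), (∀ s ∈ Q.points, ‖s‖ ≤ R → ∃ p ∈ Λ, dist (p - c) s ≤ ε) ∧ (∀ p ∈ Λ, ‖p - c‖ ≤ R → ∃ s ∈ Q.points, dist (p - c) s ≤ ε)) → ∃ (κ : ℕ → ℕ) (σ : ℕ → EuclideanSpace ℝ (Fin 3)), StrictMono κ ∧ ∀ R ε : ℝ, 0 < ε → ∀ᶠ k : ℕ in Filter.atTop, (∀ s ∈ Q.points, ‖s‖ ≤ R → ∃ i : Fin (m (κ k)), dist (z (κ k) i + σ k) s ≤ ε) ∧ (∀ i : Fin (m (κ k)), ‖z (κ k) i + σ k‖ ≤ R → ∃ s ∈ Q.points, dist (z (κ k) i + σ k) s ≤ ε) :=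
  Summit.AtomisticToContinuum.Crystallization.Theorems.stub_windowsReturn

/-! ## The assembly (sorry-free) -/

/-- **Glue A**: stubs A1–A4 give Goal A (typical centres, Gaussian form). -/
theorem typicalCentres_of_stubs : Goal.TypicalCentres := by
  intro P _hP δ hδ x hsep hS2 hS3
  exact stub_diagonalCentres P δ hδ x hsep hS2 (stub_denseCentres P δ hδ x hsep hS3)
    (stub_quietCentres P δ hδ x hsep hS3) (stub_admissibleApprox P δ hδ)

/-- **Glue B**: stubs B1–B3 give Goal B (rigidity of quiet exact windows, Gaussian form). -/
theorem quietExactWindowsRigidity_of_stubs : Goal.QuietExactWindowsRigidity := by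
  intro P hP δ hδ n y hsep h0 hE hQ
  obtain ⟨ψ, Λ, hψ, hΛsep, hΛ0, hΛE, hΛQ, hconv⟩ :=
    stub_localLimitTransfer P δ hδ n y hsep h0 hE hQ
  obtain ⟨Q, hwin⟩ := stub_limitRigidity P hP δ hδ Λ hΛsep hΛ0 hΛE hΛQ
  obtain ⟨κ, σ, hκ, hmatch⟩ :=
    stub_windowsReturn (fun k => n (ψ k)) (fun k => y (ψ k)) Λ Q hconv hwin
  exact ⟨fun k => ψ (κ k), σ, Q, hψ.comp hκ, hmatch⟩

/-- **Assembly** `Goal.TypicalCentres → Goal.QuietExactWindowsRigidity → Goal.Crux` (= the crux decl)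
(sorry-free): recentre by A, feed B with the translated subsequence (the hard core is translation
invariant), compose the two subsequences and translations, and convert eventual two-way matching of a
`δ`-separated sequence into the crux's local convergence with multiplicity `m ≡ 1`
(`PeriodicConfiguration.tendsto_sum_of_eventually_near'`). -/
theorem HcpDiffractionRigidity_of_goals (hA : Goal.TypicalCentres)
    (hB : Goal.QuietExactWindowsRigidity) : Goal.Crux := by
  show Summit.AtomisticToContinuum.Crystallization.Theses.BraggSlacknessRigidity.HcpDiffractionRigidity
  intro P hP δ hδ x hsep hS2 hS3
  obtain ⟨φ, τ, hφ, h0, hex, hq⟩ := hA P hP δ hδ x hsep hS2 hS3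
  -- the hard core is translation invariant
  have hsep' : ∀ (j : ℕ) (i i' : Fin (φ j)), i ≠ i' →
      δ ≤ dist (x (φ j) i + τ j) (x (φ j) i' + τ j) := fun j i i' hne => by
    rw [dist_add_right]
    exact hsep (φ j) i i' hne
  obtain ⟨ψ, σ, Q, hψ, hmatch⟩ :=
    hB P hP δ hδ φ (fun j i => x (φ j) i + τ j) hsep' h0 hex hq
  refine ⟨fun k => φ (ψ k), fun k => τ (ψ k) + σ k, Q, fun _ => 1, hφ.comp hψ,
    fun s _ => le_rfl, fun g _ s => rfl, fun f hfc hf => ?_⟩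
  have hsep'' : ∀ (k : ℕ) (i i' : Fin (φ (ψ k))), i ≠ i' →
      δ ≤ dist (x (φ (ψ k)) i + τ (ψ k) + σ k) (x (φ (ψ k)) i' + τ (ψ k) + σ k) :=
    fun k i i' hne => by
    rw [dist_add_right]
    exact hsep' (ψ k) i i' hne
  have key := Q.tendsto_sum_of_eventually_near' (n := fun k => φ (ψ k))
    (fun k i => x (φ (ψ k)) i + τ (ψ k) + σ k) hδ hsep'' hmatch hfc hf
  simpa only [add_assoc] using key

/-- **The skeleton IS the crux proof modulo the seven named stubs**: `HcpDiffractionRigidity` by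
name, through the sorry-free glue `typicalCentres_of_stubs`, `quietExactWindowsRigidity_of_stubs`
and `HcpDiffractionRigidity_of_goals`. -/
theorem HcpDiffractionRigidity_of :
    Summit.AtomisticToContinuum.Crystallization.Theses.BraggSlacknessRigidity.HcpDiffractionRigidity :=
  HcpDiffractionRigidity_of_goals typicalCentres_of_stubs quietExactWindowsRigidity_of_stubs

end Summit.AtomisticToContinuum.Crystallization.Cruxes.HcpDiffractionRigidity.Birth

end
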